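import Mathlib
import Summits.Ventures.HodgeRepro2.T6N5LocalDatum
import Summits.Ventures.HodgeRepro2.T6N5LocalHyp
import Summits.Ventures.HodgeRepro2.T6N5Rich

/-!
# T6N5RealPlace — condition (b) of Theorem 5.6 AT THE REAL PLACES in the route's weight form: the last
interface residual of the rich N5 datum (`SignModel.RealCondB`) reduced to the displayed Epsilon Dichotomy
(BFGYYZ 2025 Theorem 3.5, which the print states for archimedean F too) plus the archimedean Fock-model
weight dictionary of MEMO §10.4(C), with the S–E weights of the VERDICT checked in kernel

Tier 6 (README §10), sub-step N5 of the M2 discharge (t6-p7).  TIER5 N5.4 row «(b) at a real place v = τ′_j»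
and N5.12.5 record (b) at the real places as [C]: «the archimedean (U(1),U(1)) dichotomy per line: "non-zero
exactly on a half-line of weights" (MEMO §10.4(C): for L_i = W₋, χ_i(j) ≤ (m′_A(j)−1)/2; for W₊, χ_i(j) ≥
(m′_A(j)+1)/2), satisfied by the forced torus weights at the ends of the interval».  Borade's (b) at τ′_j for
the line L_i reads ω_{ℂ/ℝ}(λ_i) = ε_{ℂ/ℝ}(ξ_i, ψ_{τ′_j}, δ); by the Epsilon Dichotomy at the archimedean place
(BFGYYZ Theorem 3.5, §3.3.3: «The non-vanishing of a theta lift of a character of U(V) is treated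
separately for the archimedean case and the non-archimedean case. … When F = ℝ, the result is given by [25,
Theorem 6.1]» — arXiv v2 layer route/lit-1-BFGYYZ-arXiv2402.16808v2-textlayer.txt p0022 ll. 5–10, print
§3.3.3 p. 27 — so the print covers ℝ; t6-p8's display `Hyp.BFGYYZ2025_Thm3_5` is consumed here on an
archimedean instance of its datum — its docstring's instance bracket names the finite non-split place; the
statement displayed is the print's, which is stated for every local field of characteristic ≠ 2)
this is «Θ_{L_i,W}(χ_i ∘ i′) ≠ 0» (ϵ(L_i) = ω(λ_i), ϵ_δ(W) = 1 by H10, ξ_i = χ_W⁻¹·(χ_i)_K), and the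
non-vanishing of the (U(1),U(1)) archimedean theta lift is the half-line condition on the weight — the
Fock-model computation of MEMO §10.4(C) from Konno–Konno 2007 Lemma 5.2(i) / 5.3(1), carried here as the
named Prop `RealData.FockDict` (class IR: the one residual left of (b) at the real places; a display of
KK07 Lemma 5.2(i) on a Fock-model carrier would discharge it).

The objects: the characters of ℂ^× modulo |·| are the WEIGHTS `Wt = Multiplicative ℤ` (`ofAdd k` ↔
z ↦ (z/|z|)^k); their restriction to ℝ^× is sgn^k (`resR`), so «conjugate-symplectic» = odd weight and
«conjugate-orthogonal» = even weight — the character α of U(1) = K¹ of torus weight χ is carried, as in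
the print's §3.3.3, through α_K = α ∘ j of weight 2χ; the quadratic character ω_{ℂ/ℝ} = sgn is `η = −1`;
the splitting character χ_W = ξ′_A has the odd weight `mA'` = m′_A(j) (MEMO §10.3); the root numbers
`eps` and the theta predicate `Theta` are DATA (the datum's), related by the display.  `RealData.toLocal`
packs one real place of one side as t6-p8's `LocalSignDatum`, so the display applies verbatim.

THE RESULT: `condB_line` — the sign equation of (b) for a line at a real place from the display, the Fock
dictionary and the half-line inequality; `SignModel.ofReal` / `realCondB_ofReal` — `RealCondB` of a sign
model whose real-place signs are the real data's; `Verdict` — the S–E solution of MEMO §10.4 VERDICT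
(m′_A = (m′₁ − 2, m′_j + 2ε_j), the forced torus weights, the W₊/W₋ pattern of §10.3) with the half-line
inequalities PROVED for both sign cases (`Verdict.realA_halfLine`, `Verdict.realB_halfLine`), and
`Verdict.realCondB`: for the VERDICT data, (b) at the real places on both sides from the display and the
Fock dictionary ALONE.  Count-neutral; nothing of the scored record is changed.
§8(d): uses an L-value-free non-vanishing device: NO.
-/

namespace Summit.Ventures.HodgeRepro2.T6.N5RealPlace

open Summit.Ventures.HodgeRepro2.T6.N5LocalDatum Summit.Ventures.HodgeRepro2.T6.N5Rich
  Summit.Ventures.HodgeRepro2.T6.Hyp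

/-- The archimedean weight group: `Multiplicative.ofAdd k` is the unitary character z ↦ (z/|z|)^k of ℂ^×. -/
abbrev Wt := Multiplicative ℤ

/-- Restriction of the weight-`k` character to ℝ^×: sgn^k (so odd weight = conjugate-symplectic, even weight =
conjugate-orthogonal, GGP 2012 Lemma 3.4 at the real place). -/
def resR : Wt →* ℤˣ := zpowersHom ℤˣ (-1)

/-- `resR` on a weight. -/
theorem resR_ofAdd (k : ℤ) : resR (Multiplicative.ofAdd k) = (-1) ^ k := by
  rw [resR, zpowersHom_apply]
  rfl

/-- Even weights are conjugate-orthogonal. -/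
theorem resR_ofAdd_two_mul (χ : ℤ) : resR (Multiplicative.ofAdd (2 * χ)) = 1 := by
  rw [resR_ofAdd]
  exact Even.neg_one_zpow ⟨χ, by ring⟩

/-- Odd weights are conjugate-symplectic: the restriction is `sgn`. -/
theorem resR_ofAdd_odd {k : ℤ} (ho : Odd k) : resR (Multiplicative.ofAdd k) = -1 := by
  rw [resR_ofAdd]
  exact ho.neg_one_zpow

/-- A weight with trivial restriction is even. -/
theorem even_of_resR_eq_one {k : ℤ} (h : resR (Multiplicative.ofAdd k) = 1) : Even k := by
  rcases Int.even_or_odd k with he | ho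
  · exact he
  · rw [resR_ofAdd_odd ho] at h
    exact absurd h (by decide)

/-- THE REAL-PLACE DATA of one side at one real place τ′_j: the root numbers ε_{ℂ/ℝ}(·, ψ_{τ′_j}, δ) of the
weight characters (Borade's tuple entries), the weight m′_A(j) of the splitting character χ_W = ξ′_A, the
theta predicate «Θ_{V_s,W}(α ∘ i′_V) ≠ 0» for the hermitian line of sign s and the conjugate-orthogonal
character α_K, the signs ϵ(L_i) = ω_{ℂ/ℝ}(λ_i) of the side's two lines (W₊ ⟺ +1), η_{τ′_j}(u), and the torus
weights χ_i(j) of the two line characters.  Data only. -/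
structure RealData where
  /-- the root number of the weight character -/
  eps : Wt → ℤˣ
  /-- the weight m′_A(j) of χ_W = ξ′_A (odd) -/
  mA' : ℤ
  /-- «the theta lift of α from U(V_s) to U(W) is non-zero», α carried as α_K -/
  Theta : ℤˣ → Wt → Prop
  /-- the signs ϵ(L_i) = ω_{ℂ/ℝ}(λ_i) of the two lines -/
  sign : Fin 2 → ℤˣ
  /-- η_{τ′_j}(u) -/
  ηu : ℤˣ
  /-- the torus weights χ_i(j) of the two line characters -/
  χ : Fin 2 → ℤ

namespace RealData

variable (R : RealData)

/-- The real place as t6-p8's local sign datum: K/F = ℂ/ℝ, characters = weights, `η = sgn`, ϵ_δ(W) = 1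
(H10), `χ_W` of weight `mA'`. -/
def toLocal : LocalSignDatum where
  Char := Wt
  FChar := ℤˣ
  res := resR
  η := -1
  eps := R.eps
  χW := Multiplicative.ofAdd R.mA'
  epsdW := 1
  Theta := R.Theta
  ηLine := R.sign
  ηu := R.ηu

/-- The character α_K = α ∘ j of the line character of torus weight χ_i: weight 2χ_i. -/
def αK (i : Fin 2) : Wt := Multiplicative.ofAdd (2 * R.χ i)

/-- The conjugate-symplectic character ξ_i = χ_W⁻¹ · α_K of the line: weight 2χ_i − m′_A (the VERDICT's
«exponents 2χ_i(j) − m′_A(j)»). -/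
def ξ (i : Fin 2) : Wt := Multiplicative.ofAdd (2 * R.χ i - R.mA')

/-- `α_K` is conjugate-orthogonal. -/
theorem isCO_αK (i : Fin 2) : R.toLocal.IsCO (R.αK i) := by
  show resR (Multiplicative.ofAdd (2 * R.χ i)) = 1
  exact resR_ofAdd_two_mul _

/-- `χ_W⁻¹ · α_K = ξ_i` (in the weight group). -/
theorem χW_inv_mul_αK (i : Fin 2) :
    (Multiplicative.ofAdd R.mA')⁻¹ * R.αK i = R.ξ i := by
  unfold αK ξ
  rw [← ofAdd_neg, ← ofAdd_add]
  congr 1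
  ring

/-- THE ARCHIMEDEAN FOCK-MODEL WEIGHT DICTIONARY (MEMO §10.4(C) from Konno–Konno 2007 Lemma 5.2(i) /
5.3(1)): the (U(1),U(1)) theta lift of the conjugate-orthogonal character of weight `k` from the hermitian
line of sign `s` is non-zero exactly on a half-line — for `s = +1` (W₊) iff `k ≥ m′_A + 1`, for `s = −1`
(W₋) iff `k ≤ m′_A − 1`.  Class IR on the M2 line (the one residual of (b) at the real places left by this
file; a display of KK07 Lemma 5.2(i) on a Fock-model carrier would discharge it). -/
def FockDict : Prop :=
  ∀ (s : ℤˣ) (k : ℤ), R.Theta s (Multiplicative.ofAdd k) ↔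
    ((s = 1 → R.mA' + 1 ≤ k) ∧ (s = -1 → k ≤ R.mA' - 1))

/-- The half-line inequality of line `i` (MEMO §10.4(C)): W₊ needs 2χ_i ≥ m′_A + 1, W₋ needs 2χ_i ≤ m′_A − 1. -/
def HalfLine (i : Fin 2) : Prop :=
  (R.sign i = 1 → R.mA' + 1 ≤ 2 * R.χ i) ∧ (R.sign i = -1 → 2 * R.χ i ≤ R.mA' - 1)

/-- CONDITION (b) AT A REAL PLACE FOR ONE LINE: from the displayed Epsilon Dichotomy on the real-place
datum, the Fock dictionary and the half-line inequality, the sign equation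
ε_{ℂ/ℝ}(ξ_i, ψ, δ) = ω_{ℂ/ℝ}(λ_i) holds. -/
theorem condB_line (h35 : BFGYYZ2025_Thm3_5 R.toLocal) (hF : R.FockDict) (i : Fin 2)
    (hH : R.HalfLine i) : R.eps (R.ξ i) = R.sign i := by
  have key := h35 (R.sign i) (R.αK i) (R.isCO_αK i)
  have hθ : R.Theta (R.sign i) (R.αK i) := (hF (R.sign i) (2 * R.χ i)).mpr hH
  have h := key.mp hθ
  change R.eps ((Multiplicative.ofAdd R.mA')⁻¹ * R.αK i) = R.sign i * 1 at h
  rw [R.χW_inv_mul_αK, mul_one] at h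
  exact h

end RealData

/-- A sign model whose real-place signs are those of real-place data `RA` (side A) / `RB` (side B):
ω_{ℂ/ℝ}(λ_i) = the line sign, ε = the root number of ξ_i. -/
def SignModel.ofReal {ι : Type*} (kind : ι → PlaceKind) (D : ι → LocalSignDatum)
    (ξ : ∀ v, Fin 4 → (D v).Char) (RA RB : ι → RealData) : SignModel ι where
  kind := kind
  D := D
  ξ := ξ
  omegaRA := fun v i => (RA v).sign i
  epsRA := fun v i => (RA v).eps ((RA v).ξ i)
  omegaRB := fun v i => (RB v).sign i
  epsRB := fun v i => (RB v).eps ((RB v).ξ i)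

/-- CONDITION (b) AT THE REAL PLACES, BOTH SIDES, from the display, the Fock dictionary and the half-line
inequalities at every real place. -/
theorem realCondB_ofReal {ι : Type*} (kind : ι → PlaceKind) (D : ι → LocalSignDatum)
    (ξ : ∀ v, Fin 4 → (D v).Char) (RA RB : ι → RealData)
    (h35A : ∀ v, kind v = .re → BFGYYZ2025_Thm3_5 (RA v).toLocal)
    (h35B : ∀ v, kind v = .re → BFGYYZ2025_Thm3_5 (RB v).toLocal)
    (hFA : ∀ v, kind v = .re → (RA v).FockDict) (hFB : ∀ v, kind v = .re → (RB v).FockDict)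
    (hHA : ∀ v, kind v = .re → ∀ i, (RA v).HalfLine i)
    (hHB : ∀ v, kind v = .re → ∀ i, (RB v).HalfLine i) :
    (SignModel.ofReal kind D ξ RA RB).RealCondB := by
  intro v hv i
  exact ⟨((RA v).condB_line (h35A v hv) (hFA v hv) i (hHA v hv i)).symm,
    ((RB v).condB_line (h35B v hv) (hFB v hv) i (hHB v hv i)).symm⟩

/-- THE S–E SOLUTION OF MEMO §10.4 VERDICT (the three real places τ′₁, τ′₂, τ′₃ = `0, 1, 2`): the odd
weights m′_j = 2n_j + 1 of ξ′ (the `n j`), the sign choices ε_j ∈ {±1} at τ′₂, τ′₃ (`ε j`; `ε 0` unused),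
and the datum's root numbers / theta predicates / η(u) at each place and side (data). -/
structure Verdict where
  /-- m′_j = 2 n_j + 1 -/
  n : Fin 3 → ℤ
  /-- the sign choice ε_j of the VERDICT (two solutions per place j = 2, 3) -/
  ε : Fin 3 → ℤˣ
  /-- the root numbers at each real place, side A -/
  epsA : Fin 3 → Wt → ℤˣ
  /-- the root numbers at each real place, side B -/
  epsB : Fin 3 → Wt → ℤˣ
  /-- the theta predicates at each real place, side A -/
  ThetaA : Fin 3 → ℤˣ → Wt → Prop
  /-- the theta predicates at each real place, side B -/
  ThetaB : Fin 3 → ℤˣ → Wt → Prop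
  /-- η_{τ′_j}(u) -/
  ηu : Fin 3 → ℤˣ

namespace Verdict

variable (V : Verdict)

/-- m′_A(j) of the VERDICT: m′₁ − 2 = 2n₁ − 1 at τ′₁, m′_j + 2ε_j = 2n_j + 1 + 2ε_j at τ′₂, τ′₃. -/
def mA' (j : Fin 3) : ℤ :=
  if j = 0 then 2 * V.n 0 - 1 else 2 * V.n j + 1 + 2 * (V.ε j : ℤ)

/-- The forced torus weight of a W₊ line at τ′_j (j = 2, 3): (m′_j + 3)/2 = n_j + 2. -/
def wPlus (j : Fin 3) : ℤ := V.n j + 2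

/-- The forced torus weight of a W₋ line: (m′_j − 3)/2 = n_j − 1 (at τ′₁: (m′₁ − 3)/2 = n₁ − 1, both lines). -/
def wMinus (j : Fin 3) : ℤ := V.n j - 1

/-- The W₊/W₋ pattern of side A (lines 111, 100) per MEMO §10.3: both W₋ at τ′₁; (W₊, W₋) at τ′₂ and τ′₃
(independent of the VERDICT's parameters). -/
def signA (j : Fin 3) : Fin 2 → ℤˣ := if j = 0 then ![-1, -1] else ![1, -1]

/-- The W₊/W₋ pattern of side B (lines 101, 110) per MEMO §10.3: both W₋ at τ′₁; (W₊, W₋) at τ′₂; (W₋, W₊)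
at τ′₃. -/
def signB (j : Fin 3) : Fin 2 → ℤˣ := if j = 0 then ![-1, -1] else if j = 1 then ![1, -1] else ![-1, 1]

/-- The torus weights of side A: the W₊ line gets `wPlus`, the W₋ line `wMinus`. -/
def χA (j : Fin 3) : Fin 2 → ℤ :=
  if j = 0 then ![V.wMinus 0, V.wMinus 0] else ![V.wPlus j, V.wMinus j]

/-- The torus weights of side B. -/
def χB (j : Fin 3) : Fin 2 → ℤ :=
  if j = 0 then ![V.wMinus 0, V.wMinus 0] else if j = 1 then ![V.wPlus 1, V.wMinus 1]
    else ![V.wMinus 2, V.wPlus 2]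

/-- The real-place data of side A at τ′_j. -/
def realA (j : Fin 3) : RealData where
  eps := V.epsA j
  mA' := V.mA' j
  Theta := V.ThetaA j
  sign := signA j
  ηu := V.ηu j
  χ := V.χA j

/-- The real-place data of side B at τ′_j. -/
def realB (j : Fin 3) : RealData where
  eps := V.epsB j
  mA' := V.mA' j
  Theta := V.ThetaB j
  sign := signB j
  ηu := V.ηu j
  χ := V.χB j

/-- The half-line arithmetic at a W₋ line of τ′₁: 2(n₁ − 1) ≤ (2n₁ − 1) − 1 (equality — the end of the
interval). -/
theorem halfLine_tau1 (n : ℤ) : 2 * (n - 1) ≤ (2 * n - 1) - 1 := by omega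

/-- The half-line arithmetic at a W₊ line of τ′_j: (2n_j + 1 + 2ε_j) + 1 ≤ 2(n_j + 2) for ε_j = ±1. -/
theorem halfLine_plus (n : ℤ) (ε : ℤˣ) : (2 * n + 1 + 2 * (ε : ℤ)) + 1 ≤ 2 * (n + 2) := by
  rcases Int.units_eq_one_or ε with h | h <;> simp [h] <;> omega

/-- The half-line arithmetic at a W₋ line of τ′_j: 2(n_j − 1) ≤ (2n_j + 1 + 2ε_j) − 1 for ε_j = ±1. -/
theorem halfLine_minus (n : ℤ) (ε : ℤˣ) : 2 * (n - 1) ≤ (2 * n + 1 + 2 * (ε : ℤ)) - 1 := by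
  rcases Int.units_eq_one_or ε with h | h <;> simp [h] <;> omega

/-- THE VERDICT'S WEIGHTS SATISFY THE HALF-LINE INEQUALITIES on side A at every real place, for both sign
choices ε_j (MEMO §10.4(C): «(A)'s m′_A(j) = m′_j + 2ε_j sits at an END of this interval»). -/
theorem realA_halfLine (j : Fin 3) (i : Fin 2) : (V.realA j).HalfLine i := by
  unfold RealData.HalfLine realA mA' signA χA wPlus wMinus
  rcases Int.units_eq_one_or (V.ε 1) with h1 | h1 <;> rcases Int.units_eq_one_or (V.ε 2) with h2 | h2 <;>
    fin_cases j <;> fin_cases i <;> simp [h1, h2] <;> omega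

/-- The same on side B. -/
theorem realB_halfLine (j : Fin 3) (i : Fin 2) : (V.realB j).HalfLine i := by
  unfold RealData.HalfLine realB mA' signB χB wPlus wMinus
  rcases Int.units_eq_one_or (V.ε 1) with h1 | h1 <;> rcases Int.units_eq_one_or (V.ε 2) with h2 | h2 <;>
    fin_cases j <;> fin_cases i <;> simp [h1, h2] <;> omega

/-- CONDITION (b) AT THE THREE REAL PLACES FOR THE VERDICT DATA, both sides, from the displayed Epsilon
Dichotomy and the Fock dictionary ALONE — the S–E weights do the rest in kernel. -/
theorem realCondB (kind : Fin 3 → PlaceKind) (D : Fin 3 → LocalSignDatum)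
    (ξ : ∀ v, Fin 4 → (D v).Char)
    (h35A : ∀ j, BFGYYZ2025_Thm3_5 (V.realA j).toLocal)
    (h35B : ∀ j, BFGYYZ2025_Thm3_5 (V.realB j).toLocal)
    (hFA : ∀ j, (V.realA j).FockDict) (hFB : ∀ j, (V.realB j).FockDict) :
    (SignModel.ofReal kind D ξ V.realA V.realB).RealCondB :=
  realCondB_ofReal kind D ξ V.realA V.realB (fun j _ => h35A j) (fun j _ => h35B j)
    (fun j _ => hFA j) (fun j _ => hFB j) (fun j _ i => V.realA_halfLine j i)
    (fun j _ i => V.realB_halfLine j i)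

end Verdict

/-! ## Non-vacuity (README §10.5(ii)(c)/(d)): a toy real-place datum on which the display, the Fock dictionary
and the half-line inequalities hold jointly -/

namespace Toy

/-- The toy real-place data: `m′_A = 1`; the theta predicate IS the half-line rule; the root number of the
weight-`m` character is `+1` iff `1 ≤ m`; the lines have signs `(+1, −1)` and torus weights `(2, 0)`. -/
def toy : RealData where
  eps := fun β => if 1 ≤ Multiplicative.toAdd β then 1 else -1
  mA' := 1
  Theta := fun s α => (s = 1 → 2 ≤ Multiplicative.toAdd α) ∧ (s = -1 → Multiplicative.toAdd α ≤ 0)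
  sign := ![1, -1]
  ηu := 1
  χ := ![2, 0]

/-- The toy satisfies the Fock dictionary (by the definition of its theta predicate). -/
theorem toy_fockDict : toy.FockDict := by
  intro s k
  show ((s = 1 → 2 ≤ Multiplicative.toAdd (Multiplicative.ofAdd k)) ∧
      (s = -1 → Multiplicative.toAdd (Multiplicative.ofAdd k) ≤ 0)) ↔
    ((s = 1 → 1 + 1 ≤ k) ∧ (s = -1 → k ≤ 1 - 1))
  rw [toAdd_ofAdd]
  constructor
  · rintro ⟨h1, h2⟩
    exact ⟨fun hs => by have := h1 hs; omega, fun hs => by have := h2 hs; omega⟩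
  · rintro ⟨h1, h2⟩
    exact ⟨fun hs => by have := h1 hs; omega, fun hs => by have := h2 hs; omega⟩

/-- The displayed Epsilon Dichotomy holds on the toy real-place datum (the parity of conjugate-orthogonal
weights is what makes the root-number rule and the half-line rule agree). -/
theorem toy_thm3_5 : BFGYYZ2025_Thm3_5 toy.toLocal := by
  change ∀ (s : ℤˣ) (α : Wt), resR α = 1 →
    (((s = 1 → 2 ≤ Multiplicative.toAdd α) ∧ (s = -1 → Multiplicative.toAdd α ≤ 0)) ↔
      (if 1 ≤ Multiplicative.toAdd ((Multiplicative.ofAdd (1 : ℤ))⁻¹ * α) then (1 : ℤˣ) else -1) = s * 1)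
  intro s α hα
  have hev : Even (Multiplicative.toAdd α) := by
    apply even_of_resR_eq_one
    rw [ofAdd_toAdd]
    exact hα
  obtain ⟨m, hm⟩ := hev
  rw [toAdd_mul, toAdd_inv, toAdd_ofAdd, mul_one]
  rcases Int.units_eq_one_or s with rfl | rfl
  · constructor
    · rintro ⟨h1, -⟩
      have := h1 rfl
      rw [if_pos (by omega)]
    · intro h
      refine ⟨fun _ => ?_, fun h' => absurd h' (by decide)⟩
      by_contra hlt
      rw [if_neg (by omega)] at h
      exact absurd h (by decide)
  · constructor
    · rintro ⟨-, h2⟩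
      have := h2 rfl
      rw [if_neg (by omega)]
    · intro h
      refine ⟨fun h' => absurd h' (by decide), fun _ => ?_⟩
      by_contra hlt
      rw [if_pos (by omega)] at h
      exact absurd h (by decide)

/-- The toy's two lines satisfy the half-line inequalities. -/
theorem toy_halfLine (i : Fin 2) : toy.HalfLine i := by
  unfold RealData.HalfLine toy
  fin_cases i <;> simp

/-- JOINT NON-VACUITY of the new binders: display, Fock dictionary and half-lines at once on the toy, and the
sign equation (b) they yield. -/
theorem toy_joint : BFGYYZ2025_Thm3_5 toy.toLocal ∧ toy.FockDict ∧ (∀ i, toy.HalfLine i) ∧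
    ∀ i, toy.eps (toy.ξ i) = toy.sign i :=
  ⟨toy_thm3_5, toy_fockDict, toy_halfLine,
    fun i => toy.condB_line toy_thm3_5 toy_fockDict i (toy_halfLine i)⟩

end Toy

end Summit.Ventures.HodgeRepro2.T6.N5RealPlace
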